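import Mathlib
import Literature.Computability.Complexity.CliqueTestGraphs
import Summits.PneNP.PneNP.Theorems.ConvexRankGatesConvexGateBlindThresholds
import Summits.PneNP.PneNP.Theorems.ConvexRankGatesConvexGateBlindFewVariables
import Summits.PneNP.PneNP.Theorems.ConvexRankGatesConvexGateBlindCellVertices
import Summits.PneNP.PneNP.Theorems.ConvexRankGatesConvexGateBlindSdpSupport

/-!
# PneNP / ConvexRankGates — `ConvexGateBlind`: one CONV gate with a small PSD block is an AND of few thresholds

Helpers (`--supports stmt-PneNP-10680`): the SDP side of the crux with a SMALL semidefinite block. If a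
CONV gate `x ↦ [∃ Y ⪰ 0 (q × q), tr(Aᵢ Y) ≤ bᵢ + ∑ₑ Bᵢₑ [xₑ]]` (`B ≥ 0`, `p` rows) separates `k`-clique
vectors from `(k-1)`-colouring vectors, then — after the free trace normalisation — every colouring is
rejected by an EXTREME normalised certificate (Farkas + Krein–Milman on the dual base,
`…SdpSupport.lean`), supported on `≤ d = q² + 1` rows; on that support the normalised row part lies in the
cell of `(S, Q₀ = argmin_Q y · r(Q))`, where the linear functional `u ↦ u · (r(h) - r(Q₀))` is negative,
hence negative at a VERTEX of the cell (`…CellVertices.lean`: at most `(d + m^k + 2)^d` vertices); each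
such vertex is a non-negative threshold row valid on all `k`-cliques. So
* `pow_le_mul_of_convGate_separates` — `(k-1)^m ≤ (p+1)^d · m^k · (d + m^k + 2)^d · N`, with `N` the
  abstract per-certificate colouring count (union bound `pow_le_mul_of_thresholdRows_separates`);
* `thresholdAnd_subset_convFew`, `not_computes_cliqueFn_of_convFew` — the one-gate circuit form over
  `{∧₂, ∨₂} ∪ CONV_{s, q² ≤ t}`.
The crux-shaped corner with the matching count is `ConvexRankGatesConvexGateBlindSdpFewDimsCorner.lean`.
[folklore assembly; the counting is this route's]
-/

namespace Summit.PneNP.PneNP.Theorems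

open Matrix Finset Filter Topology

/-! ### One CONV gate with a small PSD block is an AND of few valid thresholds -/

section sdpFewDims

open Literature.Computability.Complexity

/-- **CONV gates with a small PSD block cannot separate cliques from colourings cheaply.** If a CONV gate
`x ↦ [∃ Y ⪰ 0 (q × q), tr(Aᵢ Y) ≤ bᵢ + ∑ₑ Bᵢₑ [xₑ] ∀ i < p]` (`B ≥ 0`) accepts every `k`-clique vector and
rejects every `(k-1)`-colouring vector of `K_m` (`1 ≤ k ≤ m`), then
`(k-1)^m ≤ (p+1)^d · m^k · (d + m^k + 2)^d · N` with `d = q² + 1`, where `N` bounds the colourings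
rejected by one valid non-negative threshold certificate. Proof: after trace normalisation every
rejected input is rejected by an EXTREME normalised certificate `(y, λ)` (Farkas + Krein–Milman on the
dual base), whose support `S` has `≤ d` rows (`card_support_le_of_mem_extremePoints_dualBase`); then
`y · r(h) < min_Q y · r(Q)` over `k`-sets `Q` (weak duality), so `y/∑y` lies in the cell of
`(S, Q₀ = argmin)` cut out by `u · (r(Q) - r(Q₀)) ≥ 0`, on which `u ↦ u · (r(h) - r(Q₀))` is negative
somewhere, hence at a vertex `v` (Krein–Milman); the row `x ↦ v · (r(x) - r(Q₀))` is a non-negative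
threshold valid on all `k`-cliques rejecting `h`, and there are at most `(p+1)^d m^k (d + m^k + 2)^d`
triples `(S, Q₀, v)` (`ncard_extremePoints_cell_le`). [folklore assembly; the count is this route's] -/
theorem pow_le_mul_of_convGate_separates {m k p q N : ℕ} (hkm : k ≤ m)
    (hN : ∀ w : (⊤ : SimpleGraph (Fin m)).edgeSet → ℝ, (∀ e, 0 ≤ w e) → ∀ θ : ℝ, 0 < θ →
      (∀ Q : Finset (Fin m), Q.card = k → θ ≤ ∑ e, if cliqueVec Q e = true then w e else 0) →
      (univ.filter fun h : Fin m → Fin (k - 1) =>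
        (∑ e, if colorVec h e = true then w e else 0) < θ).card ≤ N)
    (A : Fin p → Matrix (Fin q) (Fin q) ℝ) (b : Fin p → ℝ)
    (B : Fin p → (⊤ : SimpleGraph (Fin m)).edgeSet → ℝ) (hB : ∀ i e, 0 ≤ B i e)
    (hpos : ∀ Q : Finset (Fin m), Q.card = k → ∃ Y : Matrix (Fin q) (Fin q) ℝ, Y.PosSemidef ∧
      ∀ i, (A i * Y).trace ≤ b i + ∑ e, B i e * (if cliqueVec Q e then (1 : ℝ) else 0))
    (hneg : ∀ h : Fin m → Fin (k - 1), ¬ ∃ Y : Matrix (Fin q) (Fin q) ℝ, Y.PosSemidef ∧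
      ∀ i, (A i * Y).trace ≤ b i + ∑ e, B i e * (if colorVec h e then (1 : ℝ) else 0)) :
    (k - 1) ^ m ≤ (p + 1) ^ (q * q + 1) * m ^ k * (q * q + 1 + m ^ k + 2) ^ (q * q + 1) * N := by
  classical
  set d : ℕ := q * q + 1 with hd
  -- right-hand sides and the free trace bound
  set r : ((⊤ : SimpleGraph (Fin m)).edgeSet → Bool) → Fin p → ℝ :=
    fun x i => b i + ∑ e, B i e * (if x e then (1 : ℝ) else 0) with hr
  obtain ⟨R, hR, hRiff⟩ := conv_exists_traceBound A r
  -- the `k`-subsets, as a finset and as a column index type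
  set 𝒬 : Finset (Finset (Fin m)) := univ.powersetCard k with h𝒬
  have mem𝒬 : ∀ Q, Q ∈ 𝒬 ↔ Q.card = k := fun Q => by
    simp [h𝒬, Finset.mem_powersetCard]
  have h𝒬ne : 𝒬.Nonempty := by
    obtain ⟨Q, -, hQ⟩ := Finset.exists_subset_card_eq (s := (univ : Finset (Fin m)))
      (n := k) (by simpa using hkm)
    exact ⟨Q, (mem𝒬 Q).2 hQ⟩
  have card𝒬 : 𝒬.card ≤ m ^ k := by
    rw [h𝒬, Finset.card_powersetCard, Finset.card_univ, Fintype.card_fin]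
    exact Nat.choose_le_pow m k
  -- cells
  let cvec : Finset (Fin m) → {Q // Q ∈ 𝒬} → Fin p → ℝ := fun Q₀ Q i => r (cliqueVec Q.1) i - r (cliqueVec Q₀) i
  let cell : Finset (Fin p) → Finset (Fin m) → Set (Fin p → ℝ) := fun S Q₀ =>
    {u : Fin p → ℝ | (∀ i, 0 ≤ u i) ∧ (∀ i, i ∉ S → u i = 0) ∧ (∀ j, 0 ≤ cvec Q₀ j ⬝ᵥ u) ∧
      ∑ i, u i = 1}
  have hcellfin : ∀ S Q₀, ((cell S Q₀).extremePoints ℝ).Finite ∧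
      ((cell S Q₀).extremePoints ℝ).ncard ≤ (S.card + Fintype.card {Q // Q ∈ 𝒬} + 2) ^ S.card :=
    fun S Q₀ => ncard_extremePoints_cell_le S (cvec Q₀)
  -- the row index: triples `(S, Q₀, v)`
  set 𝒮 : Finset (Finset (Fin p)) := univ.filter fun S => S.card ≤ d with h𝒮
  set Rows : Finset (Finset (Fin p) × Finset (Fin m) × (Fin p → ℝ)) :=
    (𝒮 ×ˢ 𝒬).biUnion fun SQ => (hcellfin SQ.1 SQ.2).1.toFinset.image fun v => (SQ.1, SQ.2, v)
    with hRows
  have memRows : ∀ S Q₀ v, S ∈ 𝒮 → Q₀ ∈ 𝒬 → v ∈ (cell S Q₀).extremePoints ℝ → (S, Q₀, v) ∈ Rows := by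
    intro S Q₀ v hS hQ₀ hv
    rw [hRows, Finset.mem_biUnion]
    exact ⟨(S, Q₀), Finset.mem_product.2 ⟨hS, hQ₀⟩,
      Finset.mem_image.2 ⟨v, (hcellfin S Q₀).1.mem_toFinset.2 hv, rfl⟩⟩
  have Rows_spec : ∀ t ∈ Rows, t.2.1 ∈ 𝒬 ∧ t.2.2 ∈ (cell t.1 t.2.1).extremePoints ℝ := by
    intro t ht
    rw [hRows, Finset.mem_biUnion] at ht
    obtain ⟨SQ, hSQ, ht⟩ := ht
    obtain ⟨v, hv, rfl⟩ := Finset.mem_image.1 ht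
    exact ⟨(Finset.mem_product.1 hSQ).2, (hcellfin SQ.1 SQ.2).1.mem_toFinset.1 hv⟩
  have cardRows : Rows.card ≤ (p + 1) ^ d * m ^ k * (d + m ^ k + 2) ^ d := by
    calc Rows.card ≤ ∑ SQ ∈ 𝒮 ×ˢ 𝒬, ((hcellfin SQ.1 SQ.2).1.toFinset.image fun v => (SQ.1, SQ.2, v)).card :=
          Finset.card_biUnion_le
      _ ≤ ∑ SQ ∈ 𝒮 ×ˢ 𝒬, (d + m ^ k + 2) ^ d := by
          refine Finset.sum_le_sum fun SQ hSQ => Finset.card_image_le.trans ?_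
          rw [← Set.ncard_eq_toFinset_card _ (hcellfin SQ.1 SQ.2).1]
          refine (hcellfin SQ.1 SQ.2).2.trans ?_
          have hS : SQ.1.card ≤ d := (Finset.mem_filter.1 (Finset.mem_product.1 hSQ).1).2
          have hJ : Fintype.card {Q // Q ∈ 𝒬} ≤ m ^ k := by simpa using card𝒬
          calc (SQ.1.card + Fintype.card {Q // Q ∈ 𝒬} + 2) ^ SQ.1.card
              ≤ (d + m ^ k + 2) ^ SQ.1.card := Nat.pow_le_pow_left (by omega) _
            _ ≤ (d + m ^ k + 2) ^ d := Nat.pow_le_pow_right (by omega) hS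
      _ = (𝒮 ×ˢ 𝒬).card * (d + m ^ k + 2) ^ d := by rw [Finset.sum_const, smul_eq_mul]
      _ ≤ (p + 1) ^ d * m ^ k * (d + m ^ k + 2) ^ d := by
          rw [Finset.card_product]
          exact Nat.mul_le_mul_right _ (Nat.mul_le_mul (card_filter_card_le p d) card𝒬)
  -- enumerate the rows and define the threshold rows
  set T : ℕ := Rows.card with hT
  let row : Fin T → Finset (Fin p) × Finset (Fin m) × (Fin p → ℝ) := fun t => (Rows.equivFin.symm t).1
  have hrow : ∀ t, row t ∈ Rows := fun t => (Rows.equivFin.symm t).2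
  let b' : Fin T → ℝ := fun t => ∑ i, (row t).2.2 i * b i - ∑ i, (row t).2.2 i * r (cliqueVec (row t).2.1) i
  let B' : Fin T → (⊤ : SimpleGraph (Fin m)).edgeSet → ℝ := fun t e => ∑ i, (row t).2.2 i * B i e
  have hvnonneg : ∀ t i, 0 ≤ (row t).2.2 i := fun t i => (Rows_spec _ (hrow t)).2.1.1 i
  have hB' : ∀ t e, 0 ≤ B' t e := fun t e => Finset.sum_nonneg fun i _ => mul_nonneg (hvnonneg t i) (hB i e)
  -- the value of row `t` at input `x` is `v · (r(x) - r(Q₀))`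
  have hval : ∀ (t : Fin T) (x : (⊤ : SimpleGraph (Fin m)).edgeSet → Bool),
      b' t + ∑ e, B' t e * (if x e then (1 : ℝ) else 0) =
        ∑ i, (row t).2.2 i * (r x i - r (cliqueVec (row t).2.1) i) := by
    intro t x
    simp only [b', B', hr, mul_sub, Finset.sum_sub_distrib, mul_add, Finset.sum_add_distrib]
    rw [sum_sum_mul_mul_comm]
    ring
  have hval' : ∀ (Q₀ : Finset (Fin m)) (v : Fin p → ℝ) (x : (⊤ : SimpleGraph (Fin m)).edgeSet → Bool),
      (fun i => r x i - r (cliqueVec Q₀) i) ⬝ᵥ v = ∑ i, v i * (r x i - r (cliqueVec Q₀) i) := by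
    intro Q₀ v x
    simp only [dotProduct]
    exact Finset.sum_congr rfl fun i _ => mul_comm _ _
  -- rows accept every `k`-clique
  have hpos' : ∀ Q : Finset (Fin m), Q.card = k →
      ∀ t, 0 ≤ b' t + ∑ e, B' t e * (if cliqueVec Q e then (1 : ℝ) else 0) := by
    intro Q hQ t
    rw [hval, ← hval']
    exact (Rows_spec _ (hrow t)).2.1.2.2.1 ⟨Q, (mem𝒬 Q).2 hQ⟩
  -- every colouring is rejected by some row
  have hneg' : ∀ h : Fin m → Fin (k - 1),
      ∃ t, b' t + ∑ e, B' t e * (if colorVec h e then (1 : ℝ) else 0) < 0 := by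
    intro h
    -- an extreme normalised certificate
    have hinf : ¬ ∃ Y : Matrix (Fin q) (Fin q) ℝ, Y.PosSemidef ∧ Y.trace ≤ R ∧
        ∀ i, (A i * Y).trace ≤ r (colorVec h) i := fun hY => hneg h ((hRiff _).2 hY)
    obtain ⟨z₀, hz₀, hz₀neg⟩ := exists_mem_dualBase_of_infeasible A (r (colorVec h)) hR hinf
    let cz : Fin (p + 1) → ℝ := Fin.lastCases R (fun i => r (colorVec h) i)
    have hcz : ∀ z : Fin (p + 1) → ℝ, ∑ j, z j * cz j =
        ∑ i : Fin p, z (Fin.castSucc i) * r (colorVec h) i + z (Fin.last p) * R := by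
      intro z
      rw [Fin.sum_univ_castSucc]
      simp [cz]
    obtain ⟨z, hzE, hzneg⟩ := exists_extremePoint_sum_mul_neg (isCompact_dualBase A) (convex_dualBase A)
      cz hz₀ (by rw [hcz]; exact hz₀neg)
    rw [hcz] at hzneg
    obtain ⟨hz1, hz2, hz3⟩ := hzE.1
    -- its row part `y`, support `S`, and normalisation `u`
    let y : Fin p → ℝ := fun i => z (Fin.castSucc i)
    set S : Finset (Fin p) := univ.filter fun i => y i ≠ 0 with hS
    have hScard : S.card ≤ d := by
      have h1 := card_support_le_of_mem_extremePoints_dualBase A hzE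
      refine le_trans ?_ h1
      have : S.map ⟨Fin.castSucc, Fin.castSucc_injective p⟩ ⊆ univ.filter fun j => z j ≠ 0 := by
        intro j hj
        obtain ⟨i, hi, rfl⟩ := Finset.mem_map.1 hj
        exact Finset.mem_filter.2 ⟨Finset.mem_univ _, (Finset.mem_filter.1 hi).2⟩
      simpa using Finset.card_le_card this
    have hvalidQ : ∀ Q : Finset (Fin m), Q.card = k →
        0 ≤ ∑ i : Fin p, z (Fin.castSucc i) * r (cliqueVec Q) i + z (Fin.last p) * R :=
      fun Q hQ => dualBase_nonneg_of_feasible A hz1 hz2 ((hRiff _).1 (hpos Q hQ))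
    have hlt : ∀ Q : Finset (Fin m), Q.card = k →
        ∑ i, y i * r (colorVec h) i < ∑ i, y i * r (cliqueVec Q) i := by
      intro Q hQ
      have := hvalidQ Q hQ
      simp only [y]
      linarith
    have hy0 : ∀ i, 0 ≤ y i := fun i => hz1 _
    have hsy : 0 < ∑ i, y i := by
      by_contra hcon
      have hsum0 : ∑ i, y i = 0 := le_antisymm (not_lt.1 hcon) (Finset.sum_nonneg fun i _ => hy0 i)
      have hy00 : ∀ i, y i = 0 := fun i =>
        (Finset.sum_eq_zero_iff_of_nonneg (fun i _ => hy0 i)).1 hsum0 i (Finset.mem_univ i)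
      obtain ⟨Q, hQ⟩ := h𝒬ne
      have h1 := hlt Q ((mem𝒬 Q).1 hQ)
      simp [hy00] at h1
    let u : Fin p → ℝ := fun i => y i / ∑ i, y i
    -- `Q₀` minimising `u · r(Q)`
    obtain ⟨Q₀, hQ₀, hQ₀min⟩ := Finset.exists_min_image 𝒬 (fun Q => ∑ i, u i * r (cliqueVec Q) i) h𝒬ne
    have hu_cell : u ∈ cell S Q₀ := by
      refine ⟨fun i => div_nonneg (hy0 i) hsy.le, fun i hi => ?_, fun Q => ?_, ?_⟩
      · have : y i = 0 := by
          by_contra hne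
          exact hi (Finset.mem_filter.2 ⟨Finset.mem_univ _, hne⟩)
        simp [u, this]
      · rw [hval']
        have h1 := hQ₀min Q.1 Q.2
        have : ∑ i, u i * (r (cliqueVec Q.1) i - r (cliqueVec Q₀) i) =
            ∑ i, u i * r (cliqueVec Q.1) i - ∑ i, u i * r (cliqueVec Q₀) i := by
          rw [← Finset.sum_sub_distrib]
          exact Finset.sum_congr rfl fun i _ => by ring
        rw [this]
        linarith
      · simp only [u]
        rw [← Finset.sum_div, div_self hsy.ne']
    have hu_neg : ∑ i, u i * (r (colorVec h) i - r (cliqueVec Q₀) i) < 0 := by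
      have h1 := hlt Q₀ ((mem𝒬 Q₀).1 hQ₀)
      have : ∑ i, u i * (r (colorVec h) i - r (cliqueVec Q₀) i) =
          (∑ i, y i * r (colorVec h) i - ∑ i, y i * r (cliqueVec Q₀) i) / ∑ i, y i := by
        rw [sub_div, Finset.sum_div, Finset.sum_div, ← Finset.sum_sub_distrib]
        exact Finset.sum_congr rfl fun i _ => by simp only [u]; ring
      rw [this]
      exact div_neg_of_neg_of_pos (by linarith) hsy
    -- a vertex of the cell where the functional is still negative
    obtain ⟨v, hvE, hvneg⟩ := exists_extremePoint_sum_mul_neg (isCompact_cell S (cvec Q₀))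
      (convex_cell S (cvec Q₀)) (fun i => r (colorVec h) i - r (cliqueVec Q₀) i) hu_cell hu_neg
    have hSmem : S ∈ 𝒮 := Finset.mem_filter.2 ⟨Finset.mem_univ _, hScard⟩
    have hmem := memRows S Q₀ v hSmem hQ₀ hvE
    refine ⟨Rows.equivFin ⟨(S, Q₀, v), hmem⟩, ?_⟩
    rw [hval]
    have hrt : row (Rows.equivFin ⟨(S, Q₀, v), hmem⟩) = (S, Q₀, v) := by simp [row]
    rw [hrt]
    exact hvneg
  have hle := pow_le_mul_of_thresholdRows_separates hN b' B' hB' hpos' hneg'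
  exact hle.trans (Nat.mul_le_mul_right _ cardRows)

/-! ### The CONV gate class with a small PSD block -/

/-- `∧₂` and `∨₂` are CONV gates with one row and no PSD variable; more generally every AND of at most
`s` non-negative thresholds is in the small-block class `CONV_{s, q² ≤ t}`. [folklore] -/
theorem thresholdAnd_subset_convFew (s t : ℕ) :
    {g : GateFn | ∃ p : ℕ, p ≤ s ∧ ∃ (b : Fin p → ℝ) (B : Fin p → Fin g.1 → ℝ),
      (∀ i j, 0 ≤ B i j) ∧ ∀ v : Fin g.1 → Bool, g.2 v = true ↔
        ∀ i, 0 ≤ b i + ∑ j, B i j * (if v j then (1 : ℝ) else 0)}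
    ⊆ {g : GateFn | ∃ (p q : ℕ), p + q ≤ s ∧ q * q ≤ t ∧ ∃ (A : Fin p → Matrix (Fin q) (Fin q) ℝ)
      (b : Fin p → ℝ) (B : Fin p → Fin g.1 → ℝ), (∀ i j, 0 ≤ B i j) ∧ ∀ v : Fin g.1 → Bool,
        g.2 v = true ↔ ∃ Y : Matrix (Fin q) (Fin q) ℝ, Y.PosSemidef ∧
          ∀ i, (A i * Y).trace ≤ b i + ∑ j, B i j * (if v j then (1 : ℝ) else 0)} := by
  rintro g ⟨p, hp, b, B, hB, hiff⟩
  refine ⟨p, 0, by simpa using hp, by simp, fun _ => 0, b, B, hB, fun v => ?_⟩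
  rw [hiff]
  constructor
  · intro h
    exact ⟨0, Matrix.PosSemidef.zero, fun i => by simpa using h i⟩
  · rintro ⟨Y, -, hY⟩ i
    simpa using hY i

/-- The small-block class `CONV_{s, q² ≤ t}` is a sub-class of the route's `CONV_s` (drop the block
budget): the corner below is literally about the crux's gates with an extra restriction. [folklore] -/
theorem convFew_subset_conv (s t : ℕ) :
    {g : GateFn | ∃ (p q : ℕ), p + q ≤ s ∧ q * q ≤ t ∧ ∃ (A : Fin p → Matrix (Fin q) (Fin q) ℝ)
      (b : Fin p → ℝ) (B : Fin p → Fin g.1 → ℝ), (∀ i j, 0 ≤ B i j) ∧ ∀ v : Fin g.1 → Bool,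
        g.2 v = true ↔ ∃ Y : Matrix (Fin q) (Fin q) ℝ, Y.PosSemidef ∧
          ∀ i, (A i * Y).trace ≤ b i + ∑ j, B i j * (if v j then (1 : ℝ) else 0)}
    ⊆ {g : GateFn | ∃ (p q : ℕ), p + q ≤ s ∧ ∃ (A : Fin p → Matrix (Fin q) (Fin q) ℝ) (b : Fin p → ℝ)
      (B : Fin p → Fin g.1 → ℝ), (∀ i j, 0 ≤ B i j) ∧ ∀ v : Fin g.1 → Bool, g.2 v = true ↔
        ∃ Y : Matrix (Fin q) (Fin q) ℝ, Y.PosSemidef ∧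
          ∀ i, (A i * Y).trace ≤ b i + ∑ j, B i j * (if v j then (1 : ℝ) else 0)} :=
  fun _ ⟨p, q, hpq, _, A, b, B, hB, hiff⟩ => ⟨p, q, hpq, A, b, B, hB, hiff⟩

/-- **One CONV gate with a small PSD block does not compute CLIQUE, finite form.** If `3 ≤ k ≤ m` and
`(s+1)^{t+1} m^k (t + 1 + m^k + 2)^{t+1} · N < (k-1)^m`, no circuit with at most one gate over
`{∧₂, ∨₂} ∪ CONV_{s, q² ≤ t}` computes `CLIQUE(m, k)` (`N` as in `pow_le_mul_of_convGate_separates`). [folklore] -/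
theorem not_computes_cliqueFn_of_convFew {m k s t N : ℕ} (hk : 3 ≤ k) (hkm : k ≤ m) (hs : 1 ≤ s)
    (hN : ∀ w : (⊤ : SimpleGraph (Fin m)).edgeSet → ℝ, (∀ e, 0 ≤ w e) → ∀ θ : ℝ, 0 < θ →
      (∀ Q : Finset (Fin m), Q.card = k → θ ≤ ∑ e, if cliqueVec Q e = true then w e else 0) →
      (univ.filter fun h : Fin m → Fin (k - 1) =>
        (∑ e, if colorVec h e = true then w e else 0) < θ).card ≤ N)
    (hnum : (s + 1) ^ (t + 1) * m ^ k * (t + 1 + m ^ k + 2) ^ (t + 1) * N < (k - 1) ^ m)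
    (C : Circuit ((⊤ : SimpleGraph (Fin m)).edgeSet))
    (hC : C.IsOver ({GateFn.and 2, GateFn.or 2} ∪ {g : GateFn | ∃ (p q : ℕ), p + q ≤ s ∧ q * q ≤ t ∧
      ∃ (A : Fin p → Matrix (Fin q) (Fin q) ℝ) (b : Fin p → ℝ) (B : Fin p → Fin g.1 → ℝ),
        (∀ i j, 0 ≤ B i j) ∧ ∀ v : Fin g.1 → Bool, g.2 v = true ↔
          ∃ Y : Matrix (Fin q) (Fin q) ℝ, Y.PosSemidef ∧
            ∀ i, (A i * Y).trace ≤ b i + ∑ j, B i j * (if v j then (1 : ℝ) else 0)}))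
    (hsize : C.size ≤ 1) : ¬ C.Computes (cliqueFn m k) := by
  classical
  intro hcomp
  have hk1 : k - 1 < k := by omega
  have hproj : ∀ e : (⊤ : SimpleGraph (Fin m)).edgeSet, (∀ x, C.eval x = x e) → False := by
    intro e he
    obtain ⟨a, a', hab⟩ := sym2_exists_eq_mk (e : Sym2 (Fin m))
    have hne : a ≠ a' := by
      have hmem := e.2
      rw [hab, SimpleGraph.mem_edgeSet, SimpleGraph.top_adj] at hmem
      exact hmem
    let h : Fin m → Fin (k - 1) := fun v => if v = a then ⟨0, by omega⟩ else ⟨1, by omega⟩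
    have h1 : colorVec h e = true := by
      simp only [colorVec, Bool.not_eq_true', decide_eq_false_iff_not]
      rw [hab, Sym2.map_mk, Sym2.mk_isDiag_iff]
      simp only [h, if_pos rfl, if_neg (Ne.symm hne)]
      exact fun heq => absurd (Fin.mk.inj_iff.1 heq) (by norm_num)
    have h2 := hcomp (colorVec h)
    rw [he, h1, cliqueFn_colorVec h hk1] at h2
    exact Bool.noConfusion h2
  obtain ⟨gates, out, wf, wf_out⟩ := C
  rcases out with e | n
  · exact hproj e fun x => rfl
  · have hn : n < gates.length := wf_out n rfl
    have hlen : gates.length = 1 := by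
      change gates.length ≤ 1 at hsize
      omega
    obtain ⟨g, rfl⟩ := List.length_eq_one_iff.1 hlen
    have hn0 : n = 0 := by simp at hn; omega
    subst hn0
    have hev : ∀ x : (⊤ : SimpleGraph (Fin m)).edgeSet → Bool,
        Circuit.eval ⟨[g], Sum.inr 0, wf, wf_out⟩ x =
          g.op (fun a => Sum.elim x (fun _ => false) (g.args a)) := by
      intro x
      simp only [Circuit.eval, Circuit.wireVals, List.foldl_cons, List.foldl_nil, List.nil_append,
        List.getD_cons_zero]
      congr 1
      funext a
      cases g.args a <;> simp
    have hg : g.fn ∈ {g : GateFn | ∃ (p q : ℕ), p + q ≤ s ∧ q * q ≤ t ∧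
        ∃ (A : Fin p → Matrix (Fin q) (Fin q) ℝ) (b : Fin p → ℝ) (B : Fin p → Fin g.1 → ℝ),
          (∀ i j, 0 ≤ B i j) ∧ ∀ v : Fin g.1 → Bool, g.2 v = true ↔
            ∃ Y : Matrix (Fin q) (Fin q) ℝ, Y.PosSemidef ∧
              ∀ i, (A i * Y).trace ≤ b i + ∑ j, B i j * (if v j then (1 : ℝ) else 0)} := by
      have h1 := hC g (by simp)
      rcases h1 with h1 | h1
      · rcases h1 with h1 | h1
        · rw [h1]; exact thresholdAnd_subset_convFew s t (and_two_mem_thresholdAnd hs)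
        · rw [Set.mem_singleton_iff.1 h1]
          exact thresholdAnd_subset_convFew s t (or_two_mem_thresholdAnd hs)
      · exact h1
    obtain ⟨p, q, hpq, hqt, A, b, B, hB, hiff⟩ := hg
    let B' : Fin p → (⊤ : SimpleGraph (Fin m)).edgeSet → ℝ :=
      fun i e => ∑ j ∈ univ.filter (fun j : Fin g.arity => g.args j = Sum.inl e), B i j
    have hB' : ∀ i e, 0 ≤ B' i e := fun i e => Finset.sum_nonneg fun j _ => hB i j
    have hind : ∀ (x : (⊤ : SimpleGraph (Fin m)).edgeSet → Bool) (j : Fin g.arity),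
        (if Sum.elim x (fun _ => false) (g.args j) then (1 : ℝ) else 0)
          = ∑ e, if g.args j = Sum.inl e then (if x e then (1 : ℝ) else 0) else 0 := by
      intro x j
      rcases hja : g.args j with e₀ | n₀
      · simp only [Sum.elim_inl, Sum.inl.injEq]
        rw [Finset.sum_ite_eq]
        simp
      · simp
    have hkey : ∀ (x : (⊤ : SimpleGraph (Fin m)).edgeSet → Bool) (i : Fin p),
        (∑ j, B i j * (if Sum.elim x (fun _ => false) (g.args j) then (1 : ℝ) else 0))
          = ∑ e, B' i e * (if x e then (1 : ℝ) else 0) := by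
      intro x i
      simp_rw [hind, Finset.mul_sum, B', Finset.sum_mul]
      rw [Finset.sum_comm]
      refine Finset.sum_congr rfl fun e _ => ?_
      rw [Finset.sum_filter]
      refine Finset.sum_congr rfl fun j _ => ?_
      split_ifs <;> simp
    have hpos : ∀ Q : Finset (Fin m), Q.card = k → ∃ Y : Matrix (Fin q) (Fin q) ℝ, Y.PosSemidef ∧
        ∀ i, (A i * Y).trace ≤ b i + ∑ e, B' i e * (if cliqueVec Q e then (1 : ℝ) else 0) := by
      intro Q hQ
      have h1 := hcomp (cliqueVec Q)
      rw [hev, cliqueFn_cliqueVec hQ.ge] at h1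
      obtain ⟨Y, hY, hrows⟩ := (hiff _).1 h1
      refine ⟨Y, hY, fun i => ?_⟩
      have h2 := hrows i
      rwa [hkey] at h2
    have hneg : ∀ h : Fin m → Fin (k - 1), ¬ ∃ Y : Matrix (Fin q) (Fin q) ℝ, Y.PosSemidef ∧
        ∀ i, (A i * Y).trace ≤ b i + ∑ e, B' i e * (if colorVec h e then (1 : ℝ) else 0) := by
      intro h hY
      have h1 := hcomp (colorVec h)
      rw [hev, cliqueFn_colorVec h hk1] at h1
      have h3 : g.op (fun a => Sum.elim (colorVec h) (fun _ => false) (g.args a)) = true := by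
        refine (hiff _).2 ?_
        obtain ⟨Y, hY0, hrows⟩ := hY
        refine ⟨Y, hY0, fun i => ?_⟩
        rw [hkey]
        exact hrows i
      rw [h3] at h1
      exact Bool.noConfusion h1
    have hle := pow_le_mul_of_convGate_separates hkm hN A b B' hB' hpos hneg
    have hmono : (p + 1) ^ (q * q + 1) * m ^ k * (q * q + 1 + m ^ k + 2) ^ (q * q + 1) ≤
        (s + 1) ^ (t + 1) * m ^ k * (t + 1 + m ^ k + 2) ^ (t + 1) := by
      have hp : p ≤ s := by omega
      have hq1 : q * q + 1 ≤ t + 1 := by omega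
      refine Nat.mul_le_mul (Nat.mul_le_mul_right _ ?_) ?_
      · exact (Nat.pow_le_pow_left (by omega) _).trans (Nat.pow_le_pow_right (by omega) hq1)
      · exact (Nat.pow_le_pow_left (by omega) _).trans (Nat.pow_le_pow_right (by omega) hq1)
    have hle' := hle.trans (Nat.mul_le_mul_right _ hmono)
    omega

end sdpFewDims

end Summit.PneNP.PneNP.Theorems
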